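import Mathlib
import HarnessLib
import Summits.ValiantsHypothesis.ValiantsHypothesis.Theorems.SchenstedIndexPowTraceCertificateTools
import Summits.ValiantsHypothesis.ValiantsHypothesis.Theorems.SchenstedIndexCountVectors

/-!
# Route SchenstedIndex — polarisation tools for slot pencils (towards the completeness of the sector
# certificates, cruxes 16081 / 16085)

Two elementary engines for the successor step "label-consistent vanishing ⇒ vanishing on all slot
pencils" in the blueprint for `BorderPcPerThree` AS TYPED (evidence note
`BorderPcPerThree-geometric-p8g6.md` on stmt-ValiantsHypothesis-16085, step (e)):

* `sum_blockCycleVec_pencil_sum` — MULTILINEAR EXPANSION: the block-cycle sum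
  `∑_ρ v_(X_ρ(N))(π)` of a slot pencil whose slot matrices are linear combinations
  `N_s = ∑_j λ_(s,j) N_(s,j)` expands as `∑_(φ : S → ι) (∏_s λ_(s, φ s)) · ∑_ρ v_(X_ρ(N^φ))(π)` with
  `N^φ_s = N_(s, φ s)` (each slot matrix enters each block cycle exactly once);
* `sum_filter_bijective_eq_zero_of_forall_eval` — COEFFICIENT EXTRACTION: if
  `∑_φ (∏_s λ_(φ s, ℓ(s))) c_φ = 0` for ALL scalars `λ : S → ℂ` (`S = Fin t × L`, `ℓ = Prod.snd`), then the
  sum of `c_φ` over the `φ` with `s ↦ (φ s, ℓ s)` BIJECTIVE (the label-preserving slot permutations)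
  vanishes — the square-free coefficient of the polynomial identity (`MvPolynomial.funext`);
  `sum_single_comp_eq_iff_bijective` is the underlying monomial bookkeeping.

Route-independent file.  HONEST FRAMING: bookkeeping for an OPEN crux; nothing here bears on `VP ≠ VNP`.
-/

set_option linter.dupNamespace false

noncomputable section

namespace Summit.ValiantsHypothesis.ValiantsHypothesis.Theorems.SchenstedIndex

open MvPolynomial Matrix
open Literature.Computability.AlgebraicComplexity

/-! ## Multilinear expansion of block-cycle sums -/

/-- One block cycle of a pencil of linear combinations expands over choice functions:
`∏_i (∑_j λ_(q i, j) N_(q i, j))_(v i, v (i+1)) = ∑_(φ : B → ι) (∏_(s ∈ B) λ_(s, φ s)) ∏_i (N_(q i, φ (q i)))_(v i, v (i+1))`. -/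
theorem prod_cycle_sum_smul_eq_sum {S ι R : Type*} [CommRing R] [Fintype ι] [DecidableEq ι]
    {m n : ℕ} {B : Type*} [Fintype B] [DecidableEq B]
    (N : S → ι → Matrix (Fin n) (Fin n) R) (lam : S → ι → R) (emb : B → S) (q : Fin m ≃ B)
    (v : Fin m → Fin n) :
    ∏ i : Fin m, (∑ j, lam (emb (q i)) j • N (emb (q i)) j) (v i) (v (finRotate m i)) =
      ∑ φ : B → ι, (∏ s : B, lam (emb s) (φ s)) *
        ∏ i : Fin m, N (emb (q i)) (φ (q i)) (v i) (v (finRotate m i)) := by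
  simp only [Matrix.sum_apply, Matrix.smul_apply, smul_eq_mul]
  rw [Fintype.prod_sum]
  rw [← sum_arrow_eq_sum_comp q (fun κ : Fin m → ι =>
    ∏ i : Fin m, lam (emb (q i)) (κ i) * N (emb (q i)) (κ i) (v i) (v (finRotate m i)))]
  refine Finset.sum_congr rfl fun φ _ => ?_
  rw [Finset.prod_mul_distrib, ← q.prod_comp (fun s => lam (emb s) (φ s))]

/-- **Multilinear expansion of the block-cycle sum of a slot pencil**: if every slot matrix is a
linear combination `N_s = ∑_j λ_(s,j) N_(s,j)`, then
`∑_ρ v_(X_ρ(N))(π) = ∑_(φ : S → ι) (∏_s λ_(s, φ s)) · ∑_ρ v_(X_ρ(N^φ))(π)`, `N^φ_s = N_(s, φ s)`. -/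
theorem sum_blockCycleVec_pencil_sum {S ι : Type*} [Fintype S] [DecidableEq S] [Fintype ι]
    [DecidableEq ι] {m n : ℕ} (π : Finpartition (Finset.univ : Finset S))
    (N : S → ι → Matrix (Fin n) (Fin n) ℂ) (lam : S → ι → ℂ) :
    (∑ ρ : S → Fin n, ∏ B ∈ π.parts, ∑ q : Fin m ≃ ↥B, ∏ i : Fin m,
        (∑ j, lam (q i).1 j • N (q i).1 j) (ρ (q i).1) (ρ (q (finRotate m i)).1)) =
      ∑ φ : S → ι, (∏ s, lam s (φ s)) *
        ∑ ρ : S → Fin n, ∏ B ∈ π.parts, ∑ q : Fin m ≃ ↥B, ∏ i : Fin m,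
          N (q i).1 (φ (q i).1) (ρ (q i).1) (ρ (q (finRotate m i)).1) := by
  classical
  -- expand each block, then Fubini over the blocks for the choice functions `φ`
  have hblock : ∀ (ρ : S → Fin n) (B : Finset S),
      (∑ q : Fin m ≃ ↥B, ∏ i : Fin m,
        (∑ j, lam (q i).1 j • N (q i).1 j) (ρ (q i).1) (ρ (q (finRotate m i)).1)) =
      ∑ φ : ↥B → ι, (∏ s : ↥B, lam s (φ s)) *
        ∑ q : Fin m ≃ ↥B, ∏ i : Fin m, N (q i).1 (φ (q i)) (ρ (q i).1) (ρ (q (finRotate m i)).1) := by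
    intro ρ B
    simp_rw [prod_cycle_sum_smul_eq_sum N lam (Subtype.val : ↥B → S) _ (fun i => ρ _), Finset.mul_sum]
    exact Finset.sum_comm
  have hρ : ∀ ρ : S → Fin n,
      (∏ B ∈ π.parts, ∑ q : Fin m ≃ ↥B, ∏ i : Fin m,
        (∑ j, lam (q i).1 j • N (q i).1 j) (ρ (q i).1) (ρ (q (finRotate m i)).1)) =
      ∑ φ : S → ι, (∏ s, lam s (φ s)) *
        ∏ B ∈ π.parts, ∑ q : Fin m ≃ ↥B, ∏ i : Fin m,
          N (q i).1 (φ (q i).1) (ρ (q i).1) (ρ (q (finRotate m i)).1) := by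
    intro ρ
    rw [Finset.prod_congr rfl (fun B _ => hblock ρ B)]
    have hF := sum_prod_parts_eq_prod_sum π
      (fun (B : Finset S) (φ : ↥B → ι) => (∏ s : ↥B, lam s (φ s)) *
        ∑ q : Fin m ≃ ↥B, ∏ i : Fin m, N (q i).1 (φ (q i)) (ρ (q i).1) (ρ (q (finRotate m i)).1))
    refine hF.symm.trans ?_
    refine Finset.sum_congr rfl fun φ _ => ?_
    beta_reduce
    rw [Finset.prod_mul_distrib, prod_parts_prod_coe_eq_prod π (fun s => lam s (φ s))]
  simp_rw [hρ]
  rw [Finset.sum_comm]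
  refine Finset.sum_congr rfl fun φ _ => ?_
  rw [Finset.mul_sum]

/-! ## Extracting the square-free coefficient -/

/-- For a self-map `ψ` of a finite type, `∑_s e_(ψ s) = ∑_s e_s` (as exponent vectors) iff `ψ` is
bijective. -/
theorem sum_single_comp_eq_iff_bijective {S : Type*} [Fintype S] [DecidableEq S] (ψ : S → S) :
    ((∑ s, Finsupp.single (ψ s) 1 : S →₀ ℕ) = ∑ s, Finsupp.single s 1) ↔ Function.Bijective ψ := by
  classical
  constructor
  · intro h
    have hcount : ∀ u : S, (Finset.univ.filter fun s => ψ s = u).card = 1 := by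
      intro u
      have h1 := congr_arg (fun f : S →₀ ℕ => f u) h
      simp only [Finsupp.finsetSum_apply, Finsupp.single_apply] at h1
      rw [Finset.sum_ite_eq' Finset.univ u, if_pos (Finset.mem_univ _), ← Finset.card_filter] at h1
      exact h1
    have hinj : Function.Injective ψ := by
      intro a b hab
      have hle : (Finset.univ.filter fun s => ψ s = ψ b).card ≤ 1 := (hcount (ψ b)).le
      exact Finset.card_le_one.1 hle a (Finset.mem_filter.2 ⟨Finset.mem_univ _, hab⟩) b
        (Finset.mem_filter.2 ⟨Finset.mem_univ _, rfl⟩)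
    exact ⟨hinj, Finite.surjective_of_injective hinj⟩
  · intro h
    exact (Equiv.ofBijective ψ h).sum_comp (fun u => (Finsupp.single u 1 : S →₀ ℕ))

/-- **Square-free coefficient of a polynomial identity.** Let `S = Fin t × L` with label map
`Prod.snd`.  If `∑_(φ : S → Fin t) (∏_s λ_(φ s, s.2)) · c_φ = 0` for every `λ : S → ℂ`, then the sum of
`c_φ` over the `φ` for which `s ↦ (φ s, s.2)` is a bijection of `S` (the label-preserving slot
permutations) vanishes — it is the coefficient of the square-free monomial `∏_u X_u` of the zero
polynomial `∑_φ c_φ ∏_s X_(φ s, s.2)`. -/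
theorem sum_filter_bijective_eq_zero_of_forall_eval {t : ℕ} {L : Type*} [Fintype L]
    [DecidableEq L] (c : (Fin t × L → Fin t) → ℂ)
    (h : ∀ lam : Fin t × L → ℂ, ∑ φ : Fin t × L → Fin t, (∏ s, lam (φ s, s.2)) * c φ = 0) :
    ∑ φ ∈ (Finset.univ : Finset (Fin t × L → Fin t)).filter
        (fun φ => Function.Bijective (fun s : Fin t × L => (φ s, s.2))), c φ = 0 := by
  classical
  -- the polynomial `P = ∑_φ c_φ ∏_s X_(φ s, s.2)` vanishes identically
  set P : MvPolynomial (Fin t × L) ℂ :=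
    ∑ φ : Fin t × L → Fin t, C (c φ) * ∏ s, X (φ s, s.2) with hP
  have hP0 : P = 0 := by
    apply MvPolynomial.funext
    intro lam
    rw [map_zero, hP, map_sum]
    simp only [map_mul, eval_C, map_prod, eval_X]
    rw [← h lam]
    refine Finset.sum_congr rfl fun φ _ => ?_
    ring
  -- its square-free coefficient is the sum over the bijective `φ`
  have hcoeff : coeff (∑ u : Fin t × L, Finsupp.single u 1) P =
      ∑ φ ∈ (Finset.univ : Finset (Fin t × L → Fin t)).filter
        (fun φ => Function.Bijective (fun s : Fin t × L => (φ s, s.2))), c φ := by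
    rw [hP, coeff_sum]
    have hterm : ∀ φ : Fin t × L → Fin t, (C (c φ) * ∏ s, X (φ s, s.2) :
        MvPolynomial (Fin t × L) ℂ) = monomial (∑ s, Finsupp.single (φ s, s.2) 1) (c φ) := by
      intro φ
      rw [show (∏ s, X (φ s, s.2) : MvPolynomial (Fin t × L) ℂ) =
          monomial (∑ s, Finsupp.single (φ s, s.2) 1) 1 by rw [monomial_sum_one]; rfl,
        C_mul_monomial, mul_one]
    simp_rw [hterm, coeff_monomial, sum_single_comp_eq_iff_bijective]
    rw [Finset.sum_filter]
  rw [← hcoeff, hP0, coeff_zero]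

end Summit.ValiantsHypothesis.ValiantsHypothesis.Theorems.SchenstedIndex

end
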